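import Mathlib.Topology.Order.MonotoneConvergence
import Literature.Barriers.CriticalPhenomena.RigorousRGSmallParameterHHWPositivity
import Literature.Barriers.CriticalPhenomena.RigorousRGSmallParameterHHWNumerics
import Literature.Barriers.CriticalPhenomena.RigorousRGSmallParameterHHWWindow
import Literature.Barriers.CriticalPhenomena.RigorousRGSmallParameterHHWThm21Statement
import HarnessLib

/-!
# HHW Theorem 2.1 (corrected statement) PROVED: the Bleher–Sinai argument of §4

Hara–Hattori–Watanabe 2001, §4 (pp. 10–14), for the `d = 4` trajectory `h_N = R^N h_{I,s}`:
the one-step inequalities of Proposition 3.1 (the tree's `StepHyp.ineq314` … `ineq324`,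
`RigorousRGSmallParameterHHWTilt`, available along the trajectory by `stepHyp_traj`,
`RigorousRGSmallParameterHHWPositivity`), the real-arithmetic Propositions 4.1 and 4.3
(`RigorousRGSmallParameterHHWNumerics`), and the critical mass window of §2.3
(`RigorousRGSmallParameterHHWWindow`: continuity and monotonicity of `μ_{2,N}(s)`, the window
`0 < s̲_N ≤ s̄_N`) are assembled into

* `mu2_succ_lt_of_lt_one`, `mu2_le_succ` — Proposition 4.1 on the trajectory;
* `Bounds`, `bounds_succ` — Proposition 4.3 on the trajectory: (2.13) and (4.9)–(4.11) at level
  `N` give (4.9)–(4.11) at level `N + 1` and (4.12);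
* `mu2_lt_one_of_lt_sLow`, `mu2_sLow_ge`, `mu2_lt_of_lt_sUp`, `mu2_sUp_le`, `criticalMass_of_mem` —
  the window and **(2.13) on `[s̲_N, s̄_N]` for every `N`** (p. 5);
* `sLow_le_sLow_succ` — Corollary 4.2; `sUp_succ_le` — Corollary 4.4 (in the form
  `s̄_{N+1} ≤ s̄_N`, which its proof gives);
* `window_nested` — the induction "`N = N₁, N₁+1, …`" of p. 14: nested windows carrying
  (4.9)–(4.11);
* `tendsto_zero_of_le_mul_one_sub` — `a_{N+1} ≤ a_N(1 - 0.08a_N)`, `a_N ≥ 0` forces `a_N → 0`;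
* **`HaraHattoriWatanabe2001_thm21_corrected_holds`** and
  **`HaraHattoriWatanabe2001_thm21_diag_holds`** — discharging the named facts of
  `RigorousRGSmallParameterHHWThm21Statement`: Theorem 2.1 with the critical-mass strip hypothesis
  its printed proof uses for `N₀ ≤ N < N₁` (`Thm21StripHypothesis`), and its case `N₀ = N₁`
  (the original Bleher–Sinai form), hence also the `N₀ = N₁` case of the vendored
  `HaraHattoriWatanabe2001_thm21`.

The vendored `HaraHattoriWatanabe2001_thm21` itself (only (2.17) at the strip levels) is not
claimed: see the gap analysis in `RigorousRGSmallParameterHHWThm21Statement`.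

## References

* T. Hara, T. Hattori, H. Watanabe, Comm. Math. Phys. 220 (2001) 13–40, §2.3 (pp. 5–6) and §4
  (Propositions 4.1, 4.3, Corollaries 4.2, 4.4, proof of Theorem 2.1, pp. 10–14).
-/

noncomputable section

namespace Literature.Barriers.CriticalPhenomena

open _root_.MeasureTheory _root_.Filter _root_.Set
open scoped _root_.Topology

namespace HierarchicalRG

open BleherSinai

/-! ### One RG step along the trajectory: Propositions 4.1 and 4.3 -/

/-- `1 + (3/√2)·0.0045 < 2 + √2`, so (2.13) with (4.9) implies (3.13). [folklore] -/
theorem lt_two_add_sqrt2_of_le {x₂ x₄ : ℝ} (h : x₂ ≤ 1 + 3 / Real.sqrt 2 * x₄) (h4 : x₄ ≤ 0.0045) :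
    x₂ < 2 + Real.sqrt 2 := by
  have hs := one_lt_sqrt2
  have h3 : 3 / Real.sqrt 2 ≤ 3 := by
    rw [div_le_iff₀ sqrt2_pos]; nlinarith
  have : 3 / Real.sqrt 2 * x₄ ≤ 3 * 0.0045 := by
    rcases le_or_gt 0 x₄ with hx | hx
    · exact mul_le_mul h3 h4 hx (by norm_num)
    · have : 3 / Real.sqrt 2 * x₄ ≤ 0 :=
        mul_nonpos_of_nonneg_of_nonpos (div_nonneg (by norm_num) sqrt2_pos.le) hx.le
      linarith
  linarith

/-- **Proposition 4.1 (1) on the trajectory**: `μ_{2,N} < 1 ⇒ μ_{2,N+1} < μ_{2,N}` (`s > 0`).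
[cite: HaraHattoriWatanabe2001, Proposition 4.1 (1)] -/
theorem mu2_succ_lt_of_lt_one {s : ℝ} (hs : 0 < s) {N : ℕ} (h : mu2 (traj s N) < 1) :
    mu2 (traj s (N + 1)) < mu2 (traj s N) := by
  have H := stepHyp_traj hs N (by linarith [one_lt_sqrt2])
  have i := H.ineq314
  rw [← traj_succ] at i
  exact prop41_one (mu2_traj_pos hs N) h i

/-- Iterating Proposition 4.1 (1): once `μ_{2,N} < 1`, `μ_{2,M} < 1` for all `M ≥ N`.
[cite: HaraHattoriWatanabe2001, Proposition 4.1 (1) and Corollary 4.2] -/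
theorem mu2_lt_one_of_le {s : ℝ} (hs : 0 < s) {N M : ℕ} (hNM : N ≤ M) (h : mu2 (traj s N) < 1) :
    mu2 (traj s M) < 1 := by
  induction M, hNM using Nat.le_induction with
  | base => exact h
  | succ M _ ih => exact (mu2_succ_lt_of_lt_one hs ih).trans ih

/-- **Proposition 4.1 (2) on the trajectory**: `¼ > μ_{2,N} - 1 ≥ (3/√2)μ_{4,N} ≥ 0 ⇒
μ_{2,N+1} ≥ μ_{2,N}` (`s > 0`). [cite: HaraHattoriWatanabe2001, Proposition 4.1 (2)] -/
theorem mu2_le_succ {s : ℝ} (hs : 0 < s) {N : ℕ} (h4 : 0 ≤ mu4 (traj s N))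
    (hlo : 3 / Real.sqrt 2 * mu4 (traj s N) ≤ mu2 (traj s N) - 1) (hhi : mu2 (traj s N) - 1 < 1 / 4) :
    mu2 (traj s N) ≤ mu2 (traj s (N + 1)) := by
  have H := stepHyp_traj hs N (by linarith [one_lt_sqrt2])
  have i := H.ineq315
  rw [← traj_succ, H.zetaN_eq] at i
  exact prop41_two h4 hlo hhi i

/-- The bounds (4.9)–(4.11) (= (2.14)–(2.16)) at level `N` for the trajectory started at
`h_{I,s}`. [cite: HaraHattoriWatanabe2001, Proposition 4.3 eqs. (4.9)–(4.11)] -/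
def Bounds (s : ℝ) (N : ℕ) : Prop :=
  0 ≤ mu4 (traj s N) ∧ mu4 (traj s N) ≤ 0.0045 ∧
  1.6 * mu4 (traj s N) ^ 2 ≤ mu6 (traj s N) ∧ mu6 (traj s N) ≤ 6.07 * mu4 (traj s N) ^ 2 ∧
  0 ≤ mu8 (traj s N) ∧ mu8 (traj s N) ≤ 48.469 * mu4 (traj s N) ^ 3

/-- **Proposition 4.3 on the trajectory**: (2.13) and (4.9)–(4.11) at level `N` (`s > 0`) give
(4.9)–(4.11) at level `N + 1` and (4.12) `μ_{4,N+1} ≤ μ_{4,N}(1 - 0.08μ_{4,N})`.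
[cite: HaraHattoriWatanabe2001, Proposition 4.3 eqs. (4.12)–(4.14)] -/
theorem bounds_succ {s : ℝ} (hs : 0 < s) {N : ℕ} (hcm : CriticalMass s N) (hb : Bounds s N) :
    Bounds s (N + 1) ∧ mu4 (traj s (N + 1)) ≤ mu4 (traj s N) * (1 - 0.08 * mu4 (traj s N)) := by
  obtain ⟨h4, h4', h6, h6', h8, h8'⟩ := hb
  have hcm' : 1 ≤ mu2 (traj s N) ∧ mu2 (traj s N) ≤ 1 + 3 / Real.sqrt 2 * mu4 (traj s N) := hcm
  have H := stepHyp_traj hs N (lt_two_add_sqrt2_of_le hcm'.2 h4')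
  have hz := H.zetaN_eq
  have i320 := H.ineq320
  have i322 := H.ineq322
  have i323 := H.ineq323
  have i324 := H.ineq324
  have h316 := prop43_h316 hcm' h4 h4' h6 h6'
  have i321 := H.ineq321 (by rw [hz]; exact h316)
  rw [← traj_succ, hz] at i320 i321 i322 i323 i324
  have hy4 : 0 ≤ mu4 (traj s (N + 1)) := mu4_traj_nonneg hs.le (N + 1)
  have c412 := prop43_four hcm' h4 h4' h6 h6' h8 h8' i321
  have c413u := prop43_six_le hcm' h4 h4' h6 h6' i320 i322
  have c413l := prop43_six_ge hcm' h4 h4' h6 h6' h8 h8' hy4 i321 i323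
  have c414 := prop43_eight hcm' h4 h4' h6 h6' h8' i320 i324
  refine ⟨⟨hy4, ?_, c413l, c413u, mu8_traj_nonneg hs (N + 1), c414⟩, c412⟩
  nlinarith

/-! ### The critical mass window ((2.11)–(2.13)) -/

/-- The defining set of `s̲_N`. [cite: HaraHattoriWatanabe2001, §2.3 eq. (2.11)] -/
theorem sLow_def (N : ℕ) : sLow N = sInf {s : ℝ | 0 < s ∧ 1 ≤ mu2 (traj s N)} := rfl

/-- The defining set of `s̄_N`. [cite: HaraHattoriWatanabe2001, §2.3 eq. (2.12)] -/
theorem sUp_def (N : ℕ) : sUp N = sInf {s : ℝ | 0 < s ∧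
    min (1 + 3 / Real.sqrt 2 * mu4 (traj s N)) (2 + Real.sqrt 2) ≤ mu2 (traj s N)} := rfl

/-- Below `s̲_N`, `μ_{2,N} < 1`. [cite: HaraHattoriWatanabe2001, §2.3 eq. (2.11)] -/
theorem mu2_lt_one_of_lt_sLow {N : ℕ} {s : ℝ} (hs : 0 < s) (h : s < sLow N) :
    mu2 (traj s N) < 1 := by
  by_contra hge
  have hmem : s ∈ {s : ℝ | 0 < s ∧ 1 ≤ mu2 (traj s N)} := ⟨hs, not_lt.1 hge⟩
  have := csInf_le ⟨0, fun t ht => ht.1.le⟩ hmem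
  rw [← sLow_def] at this
  linarith

/-- Below `s̄_N`, `μ_{2,N} < min{1 + (3/√2)μ_{4,N}, 2 + √2}`.
[cite: HaraHattoriWatanabe2001, §2.3 eq. (2.12)] -/
theorem mu2_lt_of_lt_sUp {N : ℕ} {s : ℝ} (hs : 0 < s) (h : s < sUp N) :
    mu2 (traj s N) < min (1 + 3 / Real.sqrt 2 * mu4 (traj s N)) (2 + Real.sqrt 2) := by
  by_contra hge
  have hmem : s ∈ {s : ℝ | 0 < s ∧
      min (1 + 3 / Real.sqrt 2 * mu4 (traj s N)) (2 + Real.sqrt 2) ≤ mu2 (traj s N)} :=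
    ⟨hs, not_lt.1 hge⟩
  have := csInf_le ⟨0, fun t ht => ht.1.le⟩ hmem
  rw [← sUp_def] at this
  linarith

/-- `μ_{2,N}(s̲_N) ≥ 1` (continuity of `μ_{2,N}` in `s`, observation (1) of §2.3).
[cite: HaraHattoriWatanabe2001, §2.3 (p. 5)] -/
theorem mu2_sLow_ge (N : ℕ) : 1 ≤ mu2 (traj (sLow N) N) := by
  obtain ⟨-, -, hne, -⟩ := sLow_pos_and_le_sUp N
  have hcl : sLow N ∈ closure {s : ℝ | 0 < s ∧ 1 ≤ mu2 (traj s N)} :=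
    csInf_mem_closure hne ⟨0, fun t ht => ht.1.le⟩
  have hsub : closure {s : ℝ | 0 < s ∧ 1 ≤ mu2 (traj s N)} ⊆ {s : ℝ | 1 ≤ mu2 (traj s N)} :=
    closure_minimal (fun s hs => hs.2) (isClosed_le continuous_const (continuous_mu2_traj N))
  exact hsub hcl

/-- `μ_{2,N}(s̄_N) ≥ min{1 + (3/√2)μ_{4,N}(s̄_N), 2 + √2}` (continuity).
[cite: HaraHattoriWatanabe2001, §4 (proof of Corollary 4.4, p. 14)] -/
theorem mu2_sUp_ge (N : ℕ) :
    min (1 + 3 / Real.sqrt 2 * mu4 (traj (sUp N) N)) (2 + Real.sqrt 2) ≤ mu2 (traj (sUp N) N) := by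
  obtain ⟨-, -, -, hne⟩ := sLow_pos_and_le_sUp N
  have hcl : sUp N ∈ closure {s : ℝ | 0 < s ∧
      min (1 + 3 / Real.sqrt 2 * mu4 (traj s N)) (2 + Real.sqrt 2) ≤ mu2 (traj s N)} :=
    csInf_mem_closure hne ⟨0, fun t ht => ht.1.le⟩
  have hcont : Continuous fun s : ℝ => min (1 + 3 / Real.sqrt 2 * mu4 (traj s N)) (2 + Real.sqrt 2) :=
    ((continuous_const.mul (continuous_mu4_traj N)).const_add 1).min continuous_const
  have hsub : closure {s : ℝ | 0 < s ∧
      min (1 + 3 / Real.sqrt 2 * mu4 (traj s N)) (2 + Real.sqrt 2) ≤ mu2 (traj s N)} ⊆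
      {s : ℝ | min (1 + 3 / Real.sqrt 2 * mu4 (traj s N)) (2 + Real.sqrt 2) ≤ mu2 (traj s N)} :=
    closure_minimal (fun s hs => hs.2) (isClosed_le hcont (continuous_mu2_traj N))
  exact hsub hcl

/-- `μ_{2,N}(s̄_N) ≤ min{1 + (3/√2)μ_{4,N}(s̄_N), 2 + √2}` (continuity from the left), hence
equality ("Continuity of `μ_{2,N}` and `μ_{4,N}` in `s` imply `μ_{2,N} = 1 + (3/√2)μ_{4,N}` if
`s = s̄_N`"). [cite: HaraHattoriWatanabe2001, §4 (proof of Corollary 4.4, p. 14)] -/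
theorem mu2_sUp_le (N : ℕ) :
    mu2 (traj (sUp N) N) ≤ min (1 + 3 / Real.sqrt 2 * mu4 (traj (sUp N) N)) (2 + Real.sqrt 2) := by
  obtain ⟨hpos, hle, -, -⟩ := sLow_pos_and_le_sUp N
  have hup : 0 < sUp N := lt_of_lt_of_le hpos hle
  have hcont : Continuous fun s : ℝ => min (1 + 3 / Real.sqrt 2 * mu4 (traj s N)) (2 + Real.sqrt 2) :=
    ((continuous_const.mul (continuous_mu4_traj N)).const_add 1).min continuous_const
  have hC : IsClosed {s : ℝ | mu2 (traj s N) ≤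
      min (1 + 3 / Real.sqrt 2 * mu4 (traj s N)) (2 + Real.sqrt 2)} :=
    isClosed_le (continuous_mu2_traj N) hcont
  have hsub : Ioo 0 (sUp N) ⊆ {s : ℝ | mu2 (traj s N) ≤
      min (1 + 3 / Real.sqrt 2 * mu4 (traj s N)) (2 + Real.sqrt 2)} :=
    fun s hs => (mu2_lt_of_lt_sUp hs.1 hs.2).le
  have hmem : sUp N ∈ closure (Ioo 0 (sUp N)) := by
    rw [closure_Ioo hup.ne]; exact ⟨hup.le, le_rfl⟩
  exact (hC.closure_subset_iff.2 hsub) hmem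

/-- **(2.13) holds on the window `[s̲_N, s̄_N]`, for every `N`** ("Note also that (2.13) holds for
`s ∈ [s̲_N, s̄_N]`", p. 5): the lower half by monotonicity of `μ_{2,N}` in `s` (observation (2)),
the upper half by the definition of `s̄_N` and continuity.
[cite: HaraHattoriWatanabe2001, §2.3 eq. (2.13)] -/
theorem criticalMass_of_mem {N : ℕ} {s : ℝ} (hs : s ∈ Icc (sLow N) (sUp N)) : CriticalMass s N := by
  obtain ⟨hpos, -, -, -⟩ := sLow_pos_and_le_sUp N
  refine ⟨?_, ?_⟩
  · exact (mu2_sLow_ge N).trans (mu2_traj_mono N hpos.le (hpos.le.trans hs.1) hs.1)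
  · rcases hs.2.lt_or_eq with hlt | heq
    · exact ((mu2_lt_of_lt_sUp (hpos.trans_le hs.1) hlt).le).trans (min_le_left _ _)
    · rw [heq]; exact (mu2_sUp_le N).trans (min_le_left _ _)

/-! ### Corollaries 4.2 and 4.4: the windows are nested -/

/-- **Corollary 4.2**: `s̲_N ≤ s̲_{N+1}`. [cite: HaraHattoriWatanabe2001, Corollary 4.2] -/
theorem sLow_le_sLow_succ (N : ℕ) : sLow N ≤ sLow (N + 1) := by
  obtain ⟨-, -, hne, -⟩ := sLow_pos_and_le_sUp (N + 1)
  rw [sLow_def (N + 1)]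
  refine le_csInf hne fun s hs => ?_
  by_contra hlt
  push Not at hlt
  have h1 := mu2_lt_one_of_lt_sLow hs.1 hlt
  have h2 := mu2_succ_lt_of_lt_one hs.1 h1
  linarith [hs.2]

/-- **Corollary 4.4** (in the form its proof gives): if (4.9)–(4.11) hold at `(s̄_N, N)` then
`s̄_{N+1} ≤ s̄_N` — at `s = s̄_N` one has `μ_{2,N} = 1 + (3/√2)μ_{4,N}`, so Proposition 4.1 (2)
and (4.12) give `μ_{2,N+1} ≥ 1 + (3/√2)μ_{4,N+1}`. [cite: HaraHattoriWatanabe2001, Corollary 4.4] -/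
theorem sUp_succ_le {N : ℕ} (hb : Bounds (sUp N) N) : sUp (N + 1) ≤ sUp N := by
  obtain ⟨hpos, hle, -, -⟩ := sLow_pos_and_le_sUp N
  have hup : 0 < sUp N := lt_of_lt_of_le hpos hle
  set t := sUp N with ht
  have h4 := hb.1
  have h4' := hb.2.1
  have hcm : CriticalMass t N := criticalMass_of_mem ⟨hle, le_rfl⟩
  -- `μ_{2,N}(t) = 1 + (3/√2) μ_{4,N}(t)`
  have hlt : 1 + 3 / Real.sqrt 2 * mu4 (traj t N) < 2 + Real.sqrt 2 :=
    lt_two_add_sqrt2_of_le le_rfl h4'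
  have hmin : min (1 + 3 / Real.sqrt 2 * mu4 (traj t N)) (2 + Real.sqrt 2) =
      1 + 3 / Real.sqrt 2 * mu4 (traj t N) := min_eq_left hlt.le
  have heq : mu2 (traj t N) = 1 + 3 / Real.sqrt 2 * mu4 (traj t N) :=
    le_antisymm hcm.2 (hmin ▸ mu2_sUp_ge N)
  -- Proposition 4.1 (2) and Proposition 4.3
  have h32 : 3 / Real.sqrt 2 * mu4 (traj t N) < 1 / 4 := by
    have h3 : 3 / Real.sqrt 2 ≤ 3 := by
      rw [div_le_iff₀ sqrt2_pos]; nlinarith [one_lt_sqrt2]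
    have := mul_le_mul h3 h4' h4 (by norm_num)
    linarith
  have hmono := mu2_le_succ hup h4 (by linarith) (by linarith)
  obtain ⟨-, h412⟩ := bounds_succ hup hcm ⟨h4, h4', hb.2.2⟩
  have h4succ : mu4 (traj t (N + 1)) ≤ mu4 (traj t N) := by nlinarith
  have hmem : t ∈ {s : ℝ | 0 < s ∧
      min (1 + 3 / Real.sqrt 2 * mu4 (traj s (N + 1))) (2 + Real.sqrt 2) ≤ mu2 (traj s (N + 1))} := by
    refine ⟨hup, (min_le_left _ _).trans ?_⟩
    have : 3 / Real.sqrt 2 * mu4 (traj t (N + 1)) ≤ 3 / Real.sqrt 2 * mu4 (traj t N) :=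
      mul_le_mul_of_nonneg_left h4succ (div_nonneg (by norm_num) sqrt2_pos.le)
    linarith
  have := csInf_le ⟨0, fun u hu => hu.1.le⟩ hmem
  rwa [← sUp_def] at this

/-! ### The induction of p. 14: nested windows carrying (4.9)–(4.11) -/

/-- **Nested windows** ("We can proceed with induction on `N` …", p. 14): if (4.9)–(4.11) hold at
level `N₁` on `[s̲_{N₁}, s̄_{N₁}]`, then for every `k`, `[s̲_{N₁+k}, s̄_{N₁+k}] ⊆ [s̲_{N₁}, s̄_{N₁}]`
and (4.9)–(4.11) hold at level `N₁ + k` on `[s̲_{N₁+k}, s̄_{N₁+k}]`; moreover `s̄` is non-increasing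
and `s̲` non-decreasing along the way. [cite: HaraHattoriWatanabe2001, §4 eqs. (4.24)–(4.25)] -/
theorem window_nested {N₁ : ℕ} (hb : ∀ s ∈ Icc (sLow N₁) (sUp N₁), Bounds s N₁) (k : ℕ) :
    (∀ s ∈ Icc (sLow (N₁ + k)) (sUp (N₁ + k)), Bounds s (N₁ + k)) ∧
      sUp (N₁ + (k + 1)) ≤ sUp (N₁ + k) ∧ sLow (N₁ + k) ≤ sLow (N₁ + (k + 1)) := by
  induction k with
  | zero =>
    refine ⟨by simpa using hb, ?_, sLow_le_sLow_succ _⟩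
    obtain ⟨-, hle, -, -⟩ := sLow_pos_and_le_sUp N₁
    simpa using sUp_succ_le (hb _ ⟨hle, le_rfl⟩)
  | succ k ih =>
    obtain ⟨hbk, hupk, hlowk⟩ := ih
    obtain ⟨hpos, hle, -, -⟩ := sLow_pos_and_le_sUp (N₁ + k)
    -- (4.9)–(4.11) at level `N₁ + k + 1` on the (smaller) window
    have hbk1 : ∀ s ∈ Icc (sLow (N₁ + (k + 1))) (sUp (N₁ + (k + 1))), Bounds s (N₁ + (k + 1)) := by
      intro s hs
      have hs' : s ∈ Icc (sLow (N₁ + k)) (sUp (N₁ + k)) := ⟨hlowk.trans hs.1, hs.2.trans hupk⟩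
      have := (bounds_succ (hpos.trans_le hs'.1) (criticalMass_of_mem hs') (hbk s hs')).1
      simpa [Nat.add_assoc] using this
    refine ⟨hbk1, ?_, sLow_le_sLow_succ _⟩
    obtain ⟨-, hle1, -, -⟩ := sLow_pos_and_le_sUp (N₁ + (k + 1))
    simpa [Nat.add_assoc] using sUp_succ_le (hbk1 _ ⟨hle1, le_rfl⟩)

/-! ### `a_{N+1} ≤ a_N(1 - 0.08 a_N)` forces `a_N → 0` -/

/-- A non-negative sequence with `a_{n+1} ≤ a_n(1 - c a_n)`, `c > 0`, tends to `0`.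
[cite: HaraHattoriWatanabe2001, §4 (end of the proof of Theorem 2.1, p. 14)] -/
theorem tendsto_zero_of_le_mul_one_sub {a : ℕ → ℝ} {c : ℝ} (hc : 0 < c) (h0 : ∀ n, 0 ≤ a n)
    (hrec : ∀ n, a (n + 1) ≤ a n * (1 - c * a n)) : Tendsto a atTop (𝓝 0) := by
  have hanti : Antitone a := antitone_nat_of_succ_le fun n => by
    have := hrec n; nlinarith [h0 n, sq_nonneg (a n)]
  have hbdd : BddBelow (range a) := ⟨0, by rintro _ ⟨n, rfl⟩; exact h0 n⟩
  set L := ⨅ n, a n with hL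
  have hlim : Tendsto a atTop (𝓝 L) := tendsto_atTop_ciInf hanti hbdd
  have hL0 : 0 ≤ L := le_ciInf fun n => h0 n
  -- pass to the limit in the recursion
  have hlim1 : Tendsto (fun n => a (n + 1)) atTop (𝓝 L) := hlim.comp (tendsto_add_atTop_nat 1)
  have hlim2 : Tendsto (fun n => a n * (1 - c * a n)) atTop (𝓝 (L * (1 - c * L))) :=
    hlim.mul ((hlim.const_mul c).const_sub 1)
  have hle : L ≤ L * (1 - c * L) := le_of_tendsto_of_tendsto' hlim1 hlim2 hrec
  have h1 : c * (L * L) ≤ 0 := by linarith [hle]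
  have h2 : L * L ≤ 0 := by
    by_contra h
    push Not at h
    linarith [mul_pos hc h]
  have hL : L = 0 := mul_self_eq_zero.1 (le_antisymm h2 (mul_self_nonneg L))
  rwa [hL] at hlim

/-! ### Theorem 2.1 -/

/-- **HHW Theorem 2.1, corrected statement — PROVED** (`HaraHattoriWatanabe2001_thm21_corrected`
of `RigorousRGSmallParameterHHWThm21Statement`): under (2.14)–(2.16) at `N₀` and the critical
mass condition (2.13) at the levels `N₀ ≤ N < N₁`, for all `s ∈ [s̲_{N₁}, s̄_{N₁}]`, there is
`s_c ∈ [s̲_{N₁}, s̄_{N₁}]` with `μ_{4,N} → 0`, `μ_{2,N} → 1` at `s = s_c`. The proof is §4 of the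
paper: Propositions 4.1, 4.3 (with Proposition 3.1 and Newman's positivity, all proved in the
tree), Corollaries 4.2, 4.4, nested windows, `s_c = inf_N s̄_N`.
[cite: HaraHattoriWatanabe2001, Theorem 2.1 and §4 (pp. 10–14)] -/
theorem HaraHattoriWatanabe2001_thm21_corrected_holds : HaraHattoriWatanabe2001_thm21_corrected := by
  intro N₀ N₁ h01 hyp hstrip
  obtain ⟨hpos1, hle1, -, -⟩ := sLow_pos_and_le_sUp N₁
  -- phase (a): carry (2.14)–(2.16) from `N₀` to `N₁` on the window of `N₁`
  have hphase : ∀ N, N₀ ≤ N → N ≤ N₁ → ∀ s ∈ Icc (sLow N₁) (sUp N₁), Bounds s N := by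
    intro N hN
    induction N, hN using Nat.le_induction with
    | base =>
      intro _ s hs
      obtain ⟨⟨h4, h4'⟩, ⟨h6, h6'⟩, ⟨h8, h8'⟩, -⟩ := hyp s hs
      exact ⟨h4, h4', h6, h6', h8, h8'⟩
    | succ N hN ih =>
      intro hN1 s hs
      have hsp : 0 < s := hpos1.trans_le hs.1
      exact (bounds_succ hsp (hstrip s hs N hN (Nat.lt_of_succ_le hN1)) (ih (Nat.le_of_succ_le hN1) s hs)).1
  have hb1 : ∀ s ∈ Icc (sLow N₁) (sUp N₁), Bounds s N₁ := hphase N₁ h01 le_rfl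
  -- phase (b): nested windows
  have hnest := window_nested hb1
  set u : ℕ → ℝ := fun k => sUp (N₁ + k) with hu
  set l : ℕ → ℝ := fun k => sLow (N₁ + k) with hl
  have hu_anti : Antitone u := antitone_nat_of_succ_le fun k => (hnest k).2.1
  have hl_mono : Monotone l := monotone_nat_of_le_succ fun k => (hnest k).2.2
  have hlu : ∀ k, l k ≤ u k := fun k => (sLow_pos_and_le_sUp (N₁ + k)).2.1
  have hlu' : ∀ k m, l k ≤ u m := by
    intro k m
    rcases le_total k m with hkm | hmk
    · exact (hl_mono hkm).trans (hlu m)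
    · exact (hlu k).trans (hu_anti hmk)
  have hbdd : BddBelow (range u) := ⟨l 0, by rintro _ ⟨m, rfl⟩; exact hlu' 0 m⟩
  set sc := ⨅ k, u k with hsc
  have hsc_le : ∀ k, sc ≤ u k := fun k => ciInf_le hbdd k
  have hle_sc : ∀ k, l k ≤ sc := fun k => le_ciInf fun m => hlu' k m
  have hmem : ∀ k, sc ∈ Icc (sLow (N₁ + k)) (sUp (N₁ + k)) := fun k => ⟨hle_sc k, hsc_le k⟩
  have hscpos : 0 < sc := hpos1.trans_le (by simpa [hl] using hle_sc 0)
  refine ⟨sc, by simpa [hl, hu] using hmem 0, ?_, ?_⟩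
  · -- `μ_{4,N} → 0`
    have h4 : Tendsto (fun k => mu4 (traj sc (N₁ + k))) atTop (𝓝 0) := by
      refine tendsto_zero_of_le_mul_one_sub (c := 0.08) (by norm_num)
        (fun k => ((hnest k).1 sc (hmem k)).1) fun k => ?_
      have := (bounds_succ hscpos (criticalMass_of_mem (hmem k)) ((hnest k).1 sc (hmem k))).2
      simpa [Nat.add_assoc] using this
    rw [← tendsto_add_atTop_iff_nat N₁]
    simpa [Nat.add_comm] using h4
  · -- `μ_{2,N} → 1` by (2.13) and `μ_{4,N} → 0`
    have h4 : Tendsto (fun k => mu4 (traj sc (N₁ + k))) atTop (𝓝 0) := by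
      refine tendsto_zero_of_le_mul_one_sub (c := 0.08) (by norm_num)
        (fun k => ((hnest k).1 sc (hmem k)).1) fun k => ?_
      have := (bounds_succ hscpos (criticalMass_of_mem (hmem k)) ((hnest k).1 sc (hmem k))).2
      simpa [Nat.add_assoc] using this
    have hup : Tendsto (fun k => 1 + 3 / Real.sqrt 2 * mu4 (traj sc (N₁ + k))) atTop (𝓝 1) := by
      simpa using (h4.const_mul (3 / Real.sqrt 2)).const_add 1
    have h2 : Tendsto (fun k => mu2 (traj sc (N₁ + k))) atTop (𝓝 1) :=
      tendsto_of_tendsto_of_tendsto_of_le_of_le tendsto_const_nhds hup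
        (fun k => (criticalMass_of_mem (hmem k)).1) (fun k => (criticalMass_of_mem (hmem k)).2)
    rw [← tendsto_add_atTop_iff_nat N₁]
    simpa [Nat.add_comm] using h2

/-- **HHW Theorem 2.1 in the original Bleher–Sinai form `N₀ = N₁` — PROVED**
(`HaraHattoriWatanabe2001_thm21_diag`); this is also the case `N₀ = N₁` of the vendored
`HaraHattoriWatanabe2001_thm21`. [cite: HaraHattoriWatanabe2001, Theorem 2.1 and Remark (p. 6)] -/
theorem HaraHattoriWatanabe2001_thm21_diag_holds : HaraHattoriWatanabe2001_thm21_diag :=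
  thm21_diag_of_corrected HaraHattoriWatanabe2001_thm21_corrected_holds

end HierarchicalRG

end Literature.Barriers.CriticalPhenomena
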